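import Summits.QuantumFields.YangMills.Theorems.BalabanUVNodesN07Prop3AtRecord
import Summits.QuantumFields.YangMills.Theorems.BalabanUVNodesK0Stub1ChartDAnalytic
import HarnessLib

/-!
# BalabanUVNodes ∕ N07 — [15] PROPOSITION 3 AT NODE 00's RECORD, «DEFINED AND ANALYTIC»: the record package of `N07Prop3AtRecord.exists_prop3_T4` with the chart `D(·)` of
# class `C^ω` and its Fréchet derivative holomorphic on the weighted `ε`-ball — a by-name junction with dag k0-s1-w2's `K0Stub1ChartDAnalytic.contDiffOn_chartD`

Cell `pub-ymgap`, width seat `pub-ymgap-dag-n07-w2` generation 3 (HUMAN RULING D-0149; DAG node N07 = [15] = [Balaban1985Variational]; W-SEAT START LIST §n07 item 2 = S2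
«[15] Sect. C (47)–(49), Prop. 3 AT OBJECTS»).  `--kind proof --supports stmt-QuantumFields-20542 --as helper` (K1⁷; count-neutral; one theorem).  CONSUMED BY NAME, nothing
modified: this seat's `N07Prop3AtRecord.exists_prop3_T4` (the record edition: (45)∕(46) `H`, (47)–(49) `Dfun`, (55), (57), (59)–(62), (73), ℂ-differentiability, from dag k0-s1-w3's
`K0FlatPortBodyP.body_of_adm22_T4` and dag k0-s1-w1's `K0Stub1RecordAveragingRightInverse.exists_rightInverse_chartLog_of_flatH`) and dag k0-s1-w2's
`K0Stub1ChartDAnalytic.contDiffOn_chartD` ∕ `differentiableOn_fderiv_chartD` (EVERY solution family of (49) with the (55) bound is `C^ω` on the ball, by the implicit function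
theorem in class `ω` — keyed on exactly the (55)∕(49) conjuncts the record package exports).

THE PRINT ([15] p. 289): «PROPOSITION 3. The transformation (47) … is defined and analytic for A′ satisfying (43) with ε₃ sufficiently small»; p. 292 «The functional derivative
of V(A′) is an analytic function».

WHAT IS PROVED (sorry-free; no definition; axioms standard).  ★★★★ `exists_prop3_T4_analytic` — `exists_prop3_T4` verbatim with two more conjuncts: `ContDiffOn ℂ ω Dfun` and
`DifferentiableOn ℂ (fderiv ℂ Dfun)` on the weighted `ε`-ball `{∀ b, w 1 b·‖A′ b‖ < ε}` — for every `T4Family`, every (2.2)-admissible nested family at the thresholds of Cor. 2.8,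
every level-weight family, every `ε` in the window, NO operator hypothesis.

HONEST FRAMING: a two-line junction of two lanes' theorems by name; (73) at norm level (kernel decay NOT here); fibre `M_ι(ℂ)` (reality: `N07ChartDValued` ∕ `N07ChartLogReality`,
with (hSH) displayed); nothing of [15] Sects. D–F asserted; stub 1 ∕ K0⁷ ∕ K1⁷ NOT closed; N07 NOT discharged; counts unmoved (5∕28); one finite T⁴ programme at fixed ε — NOT
continuum ∕ ℝ⁴ ∕ OS ∕ mass gap ∕ Clay: the Yang–Mills mass gap is NOT proved by any of this; R4 closes the conditional rung `BalabanLadder.UV` only.  No `sorry`, no `def`, no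
`instance`, no `notation`.

References: [15] T. Bałaban, CMP 102 (1985) 277–309 [Balaban1985Variational] ((43)–(62) pp.285–287, (70)–(73) p.289, Prop. 3 p.289, Prop. 4 p.292); T. Bałaban, CMP 96 (1984)
223–250 [Balaban1984PropagatorsII] (Cor. 2.8 p.249); [I] CMP 109 (1987) 249–301 [Balaban1987RG1] ((0.1) p.251).
-/

noncomputable section

open scoped BigOperators Matrix.Norms.L2Operator ContDiff
open NormedSpace Metric Set

namespace Summit.QuantumFields.YangMills.BalabanUVNodes.N07Prop3AtRecordAnalytic

open Literature.MathematicalPhysics.QuantumFieldTheory.Balaban1983to89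
open Literature.MathematicalPhysics.QuantumFieldTheory.Balaban1983to89.T4Continuum (T4Family)
open Literature.MathematicalPhysics.QuantumFieldTheory.Balaban1983to89.B6SectADomainsV1 (Domains)
open Literature.MathematicalPhysics.QuantumFieldTheory.Balaban1983to89.B6SectAOperatorsV1 (BondIdx)
open Summit.QuantumFields.YangMills.Theorems.FlatCubeOpsText (Adm22)
open Summit.QuantumFields.YangMills.Theorems.K0FlatCubeOpsTextP (IsLevWeight)
open Summit.QuantumFields.YangMills.Theorems.Prop8Chart (chartLog)
open Summit.QuantumFields.YangMills.Theorems.K0Stub1ChartDAnalytic (contDiffOn_chartD differentiableOn_fderiv_chartD)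
open Summit.QuantumFields.YangMills.BalabanUVNodes.N07Prop3AtRecord (exists_prop3_T4)

variable {ι : Type*} [Fintype ι] [DecidableEq ι] [Nonempty ι]

/-- ★★★★ **[15] PROPOSITION 3 AT NODE 00's RECORD — DEFINED AND ANALYTIC, NO OPERATOR HYPOTHESIS.**  `N07Prop3AtRecord.exists_prop3_T4` (binders verbatim: `body_of_adm22_T4`'s
thresholds + `2L ≤ R` + the `ε`-window) with, in addition, `Dfun` of class `C^ω` and `fderiv ℂ Dfun` holomorphic on the weighted `ε`-ball — dag k0-s1-w2's `contDiffOn_chartD` ∕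
`differentiableOn_fderiv_chartD` applied to the record package's own (55)∕(49) conjuncts and its right inverse `H` with the (46) letter `B`.
[cite: Balaban1985Variational, Prop. 3 p.289, (47)-(49) p.285, (55) p.286, (73) p.289, Prop. 4 p.292; Balaban1984PropagatorsII, Cor. 2.8 p.249; Balaban1987RG1, (0.1) p.251] -/
theorem exists_prop3_T4_analytic (F : T4Family) :
    ∃ (Mh₀ R₀ : ℕ) (B : ℝ), 0 ≤ B ∧
    ∀ (n K : ℕ) (_ : 1 ≤ K - n) (_ : K - n + 1 ≤ F.m + K) {Mh R a' : ℕ} (_ : Mh = F.L ^ a') (_ : Mh₀ ≤ Mh) (_ : R₀ ≤ R) (_ : 2 * F.L ≤ R)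
      (_ : a' + 3 ≤ F.m + n) (D : Domains (F.P K)) (_ : D.k = K - n) (_ : Adm22 D R (F.L * Mh))
      (w : ℕ → PBond (F.P K) 0 → ℝ) (_ : IsLevWeight (F.P K) (K - n) D w) {ε : ℝ} (_ : 0 < ε)
      (_ : 18 * (960 * ((((F.P K).d + 2) * (F.P K).L : ℕ) : ℝ) * ((F.P K).L : ℝ) / (12800 * ((((F.P K).d + 2) * (F.P K).L : ℕ) : ℝ) ^ 2 * ((F.P K).L : ℝ))⁻¹) *
        B * ε ≤ 1)
      (_ : 64 * ε ≤ (12800 * ((((F.P K).d + 2) * (F.P K).L : ℕ) : ℝ) ^ 2 * ((F.P K).L : ℝ))⁻¹),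
      let η : ℝ := (((F.P K).L : ℝ)⁻¹) ^ (K - n)
      let Rs : ℝ := (12800 * ((((F.P K).d + 2) * (F.P K).L : ℕ) : ℝ) ^ 2 * ((F.P K).L : ℝ))⁻¹
      let C₂ : ℝ := 960 * ((((F.P K).d + 2) * (F.P K).L : ℕ) : ℝ) * ((F.P K).L : ℝ) / Rs
      let C₃ : ℝ := 3840 * ((((F.P K).d + 2) * (F.P K).L : ℕ) : ℝ) * ((F.P K).L : ℝ) / Rs
      let Qlin := (fderiv ℂ (chartLog η D : (PBond (F.P K) 0 → Matrix ι ι ℂ) → BondIdx D → Matrix ι ι ℂ) 0)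
      ∃ (H : (BondIdx D → Matrix ι ι ℂ) →ₗ[ℂ] (PBond (F.P K) 0 → Matrix ι ι ℂ))
        (Dfun : (PBond (F.P K) 0 → Matrix ι ι ℂ) → (BondIdx D → Matrix ι ι ℂ)),
        (∀ X, Qlin (H X) = X) ∧
        (∀ (X : BondIdx D → Matrix ι ι ℂ) (t : ℝ), 0 ≤ t → (∀ i, ‖X i‖ ≤ t) → ∀ b, w 1 b * ‖H X b‖ ≤ B * t) ∧
        DifferentiableOn ℂ Dfun {A' : PBond (F.P K) 0 → Matrix ι ι ℂ | ∀ b, w 1 b * ‖A' b‖ < ε} ∧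
        ContDiffOn ℂ ω Dfun {A' : PBond (F.P K) 0 → Matrix ι ι ℂ | ∀ b, w 1 b * ‖A' b‖ < ε} ∧
        DifferentiableOn ℂ (fderiv ℂ Dfun) {A' : PBond (F.P K) 0 → Matrix ι ι ℂ | ∀ b, w 1 b * ‖A' b‖ < ε} ∧
        (∀ A' : PBond (F.P K) 0 → Matrix ι ι ℂ, (∀ b, w 1 b * ‖A' b‖ < ε) →
          (∀ (ρ : ℝ), 0 ≤ ρ → (∀ b, w 1 b * ‖A' b‖ ≤ ρ) → ∀ i, ‖Dfun A' i‖ ≤ 4 * C₂ * ρ ^ 2) ∧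
          chartLog η D (A' - H (Dfun A')) - Qlin (A' - H (Dfun A')) = Dfun A' ∧
          chartLog η D (A' - H (Dfun A')) = Qlin A' ∧
          (∃ 𝔇 : (PBond (F.P K) 0 → Matrix ι ι ℂ) →L[ℂ] (BondIdx D → Matrix ι ι ℂ), HasFDerivAt Dfun 𝔇 A' ∧
            ∀ (W : PBond (F.P K) 0 → Matrix ι ι ℂ) (t : ℝ), 0 ≤ t → (∀ b, w 1 b * ‖W b‖ ≤ t) → ∀ i, ‖𝔇 W i‖ ≤ 4 * C₃ * ε * t) ∧
          (∀ (ρ : ℝ), 0 ≤ ρ → (∀ b, w 1 b * ‖A' b‖ ≤ ρ) → ∀ b, w 1 b * ‖(A' - H (Dfun A')) b‖ ≤ ρ + B * (4 * C₂ * ρ ^ 2))) ∧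
        (∀ A : PBond (F.P K) 0 → Matrix ι ι ℂ, (∀ b, w 1 b * ‖A b‖ < ε / 2) →
          (∀ b, w 1 b * ‖(A + H (chartLog η D A - Qlin A)) b‖ < ε) ∧
          Dfun (A + H (chartLog η D A - Qlin A)) = chartLog η D A - Qlin A ∧
          (A + H (chartLog η D A - Qlin A)) - H (Dfun (A + H (chartLog η D A - Qlin A))) = A) := by
  obtain ⟨Mh₀, R₀, B, hB, hmain⟩ := exists_prop3_T4 (ι := ι) F
  refine ⟨Mh₀, R₀, B, hB, ?_⟩
  intro n K hk1 hk' Mh R a' hMha hMh hR h2L hsize D hDk hAdm w hw ε hε h18 h64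
  obtain ⟨H, Dfun, hHinv, hHB, hdiff, hA, hrange⟩ := hmain n K hk1 hk' hMha hMh hR h2L hsize D hDk hAdm w hw hε h18 h64
  have hM1 : 1 ≤ F.L * Mh := by
    have hL := F.hL.2
    rw [hMha]; exact Nat.one_le_iff_ne_zero.mpr (Nat.mul_ne_zero (by omega) (pow_ne_zero _ (by omega)))
  have h2L' : 2 * (F.P K).L ≤ R := h2L
  have h55 := fun A' hA' => (hA A' hA').1
  have h49 := fun A' hA' => (hA A' hA').2.1
  exact ⟨H, Dfun, hHinv, hHB, hdiff,
    contDiffOn_chartD (K - n) h2L' hM1 D hDk hAdm hw H hHinv hB hHB hε h18 h64 Dfun h55 h49,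
    differentiableOn_fderiv_chartD (K - n) h2L' hM1 D hDk hAdm hw H hHinv hB hHB hε h18 h64 Dfun h55 h49, hA, hrange⟩

end Summit.QuantumFields.YangMills.BalabanUVNodes.N07Prop3AtRecordAnalytic

end
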